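/-
Copyright (c) 2026 the pub-hodgecm-mathlib formalisation cell (harness21).  Prover seat hodgecm-mathlib-K2E1b-p15 (g0), Track B ∕ K2-LIT
(build stream 29), h413 = `stmt-HodgeConjecture-24833`, line `K2_E1b_GKCohomologyU21`, socket module «U456 Cohomology» (U5), file #17 — the payment of
`K2E1bGKCohomologyU21.U456.sig_K2E1bDegOneFinrankEqTwo` TOKEN FOR TOKEN.  2026-09-03.
-/
import Summits.HodgeConjecture.HodgeConjecture.Theorems.F0P3bArchDegOnePackage   -- ★ T6b `stub_T6b_degOneTypeFinrank`, `IsCohUnitaryIrrep`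
import Mathlib.LinearAlgebra.Complex.FiniteDimensional                          -- `Complex.finrank_real_complex`
import HarnessLib

/-!
# h413 ∕ Track B «K2-LIT», line `K2_E1b_GKCohomologyU21`, unit U5 «PINS + ROW 10»: `dim_ℝ H¹_δ = 2` EXACTLY for a non-zero degree-one Hodge piece
# (payment of `Cruxes/H413/Lines/K2_E1b_GKCohomologyU21_U456_Cohomology.lean :: sig_K2E1bDegOneFinrankEqTwo`, statement bytes frozen)

Cell `pub/hodgecm-mathlib`, crux H413 = `stmt-HodgeConjecture-24833`, route of record `HCCMUnconditional`; chair K2-lead (g0), dealer K2E1b-plan (g0),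
EMIT «SKELETON LANDED K2E1b» (REQUESTS l.72387) file #17 `sig_K2E1bDegOneFinrankEqTwo` (M; ROW-10 service for `stub_multiplicity_le_one_printed`,
a3_liu413.lean:302, dim-1 half) ↦ seat K2E1b-p15.  THEOREMS ONLY (no `def`, no `instance`, no `notation`, no named-fact hypothesis, no `sorry`);
imports = ★ `Theorems/F0P3bArchDegOnePackage` + Mathlib + HarnessLib; lane `--supports stmt-HodgeConjecture-24833 --as helper` (count-neutral).

THE STATEMENT (bytes of the socket).  For every irreducible unitary cohomological `(𝔲(2,1), K)`-module `(V, ρK, ρ𝔤)` (★ `IsCohUnitaryIrrep`) and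
`δ = ±1`: if the degree-one Hodge piece `H¹_δ = upqTypeClasses ρK ρ𝔤 _ 1 δ` (★ `UpqHodgeBigrading`, the classes of type-`δ` `(𝔤, K)`-cocycles) is
non-zero, then `Module.finrank ℝ H¹_δ = 2` — i.e. `dim_ℂ H¹_δ(J^δ) = 1`, Borel–Wallach VI Thm. 4.11 (3) «… and these spaces are one dimensional»,
Rogawski Prop. 15.2.1 (b) «H¹(π ⊗ F) = ℂ».

THE PROOF (strategy: «a complex line squeezed under the T6b ceiling» — no cocycle-level work is redone).
* UPPER BOUND + FINITENESS: ★ T6b `F0P3bArchDegOnePackage.stub_T6b_degOneTypeFinrank` (BW VI 4.11 (3) as proved in the tree from T3j + T6g + T6k):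
  `H¹_δ` is a finite real vector space with `finrank_ℝ ≤ 2`.
* COMPLEX STABILITY (§1, `upqTypeClasses_smul_mem`, any `U(α, β)`, any degree and type): `H^n(𝔤, K; V)` is a complex vector space with
  `c • [z] = [c • z]` (★ `ChevalleyEilenberg.Subcomplex.smul_toCohomology`, instance ★ `gkCohomology.instModuleComplex`, BW I §5.1 (1)), and the
  type-`δ` cochains are a complex subspace (★ `upq_smul_mem_type`, BW II §4.2 (3)); hence the real submodule `H^n_δ` is closed under the complex scalars.
* LOWER BOUND (§2): a non-zero class `x ∈ H¹_δ` spans the complex line `ℂ • x ⊆ H¹_δ`, the range of the INJECTIVE real-linear map `c ↦ c • x`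
  (`ℂ` is a field), of real dimension `finrank_ℝ ℂ = 2` (Mathlib `Complex.finrank_real_complex`); `Submodule.finrank_mono` under the T6b finiteness.
The hypothesis `δ = 1 ∨ δ = -1` of the socket is not used (for other `δ` the piece vanishes, ★ `typeOne_eq_zero_of_sq_ne_one`, so the implication
is vacuous there); it is kept because the statement bytes are frozen.

* §1 `upqTypeClasses_smul_mem`   · `H^n_δ(𝔲(α,β), K; V)` is stable under `ℂ` (generic glue, reusable by U4∕U6 files);
* §1 `two_le_finrank_of_ne_bot`  · a non-zero finite `H^n_δ` has `2 ≤ finrank_ℝ` (generic);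
* §2 **`DegOneFinrankEqTwo`**     · `sig_K2E1bDegOneFinrankEqTwo` TOKEN FOR TOKEN (tie probe
      `example : type_of% @DegOneFinrankEqTwo = type_of% @K2E1bGKCohomologyU21.U456.sig_K2E1bDegOneFinrankEqTwo := rfl`
      at home once the socket module is built on stream 29: `K2/K2E1b-p15/g0/Probe_K2E1bDegOneFinrankEqTwo.lean`).

WHAT IS NOT HERE.  The identification of `H¹_δ` with `Hom_K(𝔭^δ, V)` or with a `K`-type line (U6, file #18), the vanishing `H¹_{−δ}(J^δ) = 0`
(★ T6a), and the class-level pin `[J^δ] = archDegOneClass δ` (file #16) — other sockets of the same module.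

HONEST LABEL.  HC_CM is proved only modulo the 7 printed citations (2 remaining named inputs: hLiu418 = `stmt-HodgeConjecture-24832`, h413 =
`stmt-HodgeConjecture-24833`) until rung 0 closes; this file moves no counter.

## References
* [BorelWallach2000] A. Borel, N. Wallach, *Continuous cohomology, discrete subgroups, and representations of reductive groups*, 2nd ed.,
  Math. Surveys Monogr. 67, AMS (2000): VI Thm. 4.11 (3) p. 131 («these spaces are one dimensional»; chunk p0168 L6–9), I §5.1 (1) (complex structure
  of `H^q(𝔤, K; V)`), II §4.2 (3) (types are complex subspaces).
* [Rogawski1990] J. Rogawski, *Automorphic representations of unitary groups in three variables*, Ann. of Math. Stud. 123 (1990), Prop. 15.2.1 (b)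
  p. 249 («H¹(π ⊗ F) = ℂ»; chunk p0244 L10–13).
-/

set_option autoImplicit false
-- the mandated namespace repeats the single-problem summit's segment (`HodgeConjecture.HodgeConjecture`)
set_option linter.dupNamespace false

noncomputable section

namespace Summit.HodgeConjecture.HodgeConjecture.Cruxes.H413.K2E1bDegOneFinrankEqTwo

open Literature.Algebra.Lie Literature.Algebra.Lie.ChevalleyEilenberg
open Literature.NumberTheory.Automorphic
open Literature.RepresentationTheory
open Literature.RepresentationTheory.BorelWallach2000
open Literature.RepresentationTheory.KonnoKonno2007 Literature.RepresentationTheory.KonnoKonno2007.RealDualPair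
open Literature.RepresentationTheory.KonnoKonno2007.RealDualPair.UForm
open Summit.HodgeConjecture.HodgeConjecture.Cruxes.H413.F0P3bArchDegOnePackage (IsCohUnitaryIrrep stub_T6b_degOneTypeFinrank)

-- Mathlib idiom (`Mathlib/Algebra/Lie/OfAssociative.lean`, and ★ `GKModules`, `GKCohomology`, the `Upq*` files, the socket module itself):
-- commutator bracket on `Module.End ℂ V`, needed to even state `ρ𝔤 : 𝔲(2,1) →ₗ⁅ℝ⁆ Module.End ℂ V` with the socket's bytes
attribute [local instance 100] LieRing.ofAssociativeRing

/-! ## §1 `H^n_δ(𝔲(α,β), K; V)` is a complex subspace of `H^n(𝔤, K; V)` -/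

section Glue

variable {α β : Type} [Fintype α] [DecidableEq α] [Fintype β] [DecidableEq β]
  {V : Type} [AddCommGroup V] [Module ℂ V]
  (ρK : Representation ℂ (uFormGroup α β).maximalCompact V)
  (ρ𝔤 : (uFormGroup α β).lie →ₗ⁅ℝ⁆ Module.End ℂ V)
  (hV : ∀ (k : (uFormGroup α β).maximalCompact) (X : (uFormGroup α β).lie), ρK k ∘ₗ ρ𝔤 X ∘ₗ ρK k⁻¹ =
    ρ𝔤 ((uFormGroup α β).Ad (Subgroup.inclusion (uFormGroup α β).maximalCompact_le_carrier k) X))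

/-- **`H^n_δ` is closed under the complex scalars**: the classes of type-`δ` `(𝔤, K)`-cocycles of `U(α, β)` form a complex subspace of the
complex vector space `H^n(𝔲(α,β), K; V)` — `c • [z] = [c • z]` and `c • z` is again a cocycle of type `δ`.
[cite: BorelWallach2000, I §5.1 (1); II §4.2 (3)] -/
theorem upqTypeClasses_smul_mem (n : ℕ) (δ : ℤ) (c : ℂ) {x : gkCohomology (uFormGroup α β) ρK ρ𝔤 hV n}
    (hx : x ∈ upqTypeClasses ρK ρ𝔤 hV n δ) : c • x ∈ upqTypeClasses ρK ρ𝔤 hV n δ := by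
  obtain ⟨z, hz, rfl⟩ := hx
  have hzt : (z : Cochain ℝ (uFormGroup α β).lie (GKCarrier (uFormGroup α β) ρ𝔤) n) ∈ upqType ρK ρ𝔤 hV n δ :=
    Submodule.mem_comap.1 hz
  rw [Subcomplex.smul_toCohomology]
  exact ⟨_, Submodule.mem_comap.2 (upq_smul_mem_type ρK ρ𝔤 hV c _ hzt), rfl⟩

/-- **A non-zero Hodge piece `H^n_δ` of finite real dimension has `finrank_ℝ ≥ 2`**: a non-zero class `x` spans the complex line `ℂ • x ⊆ H^n_δ`,
the range of the injective real-linear map `c ↦ c • x`, of real dimension `finrank_ℝ ℂ = 2`. [cite: BorelWallach2000, I §5.1 (1)] -/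
theorem two_le_finrank_of_ne_bot (n : ℕ) (δ : ℤ) [Module.Finite ℝ ↥(upqTypeClasses ρK ρ𝔤 hV n δ)]
    (hne : upqTypeClasses ρK ρ𝔤 hV n δ ≠ ⊥) : 2 ≤ Module.finrank ℝ ↥(upqTypeClasses ρK ρ𝔤 hV n δ) := by
  obtain ⟨x, hx, hx0⟩ := (Submodule.ne_bot_iff _).1 hne
  -- the complex line through `x`, as the range of a real-linear map `ℂ → H^n`
  let Φ : ℂ →ₗ[ℝ] gkCohomology (uFormGroup α β) ρK ρ𝔤 hV n :=
    (LinearMap.toSpanSingleton ℂ (gkCohomology (uFormGroup α β) ρK ρ𝔤 hV n) x).restrictScalars ℝ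
  have hΦ : ∀ c : ℂ, Φ c = c • x := fun c => rfl
  have hinj : Function.Injective Φ := by
    refine (injective_iff_map_eq_zero Φ).2 fun c hc => ?_
    rw [hΦ] at hc
    exact (smul_eq_zero.1 hc).resolve_right hx0
  have hle : LinearMap.range Φ ≤ upqTypeClasses ρK ρ𝔤 hV n δ := by
    rintro _ ⟨c, rfl⟩
    rw [hΦ]
    exact upqTypeClasses_smul_mem ρK ρ𝔤 hV n δ c hx
  calc 2 = Module.finrank ℝ ℂ := Complex.finrank_real_complex.symm
    _ = Module.finrank ℝ ↥(LinearMap.range Φ) := (LinearMap.finrank_range_of_inj hinj).symm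
    _ ≤ Module.finrank ℝ ↥(upqTypeClasses ρK ρ𝔤 hV n δ) := Submodule.finrank_mono hle

end Glue

/-! ## §2 The socket `sig_K2E1bDegOneFinrankEqTwo`, TOKEN FOR TOKEN -/

/-- **`dim_ℝ H¹_δ = 2` (i.e. `dim_ℂ H¹_δ(J^δ) = 1`) for a non-zero degree-one Hodge piece of an irreducible unitary cohomological
`(𝔲(2,1), K)`-module, `δ = ±1`** — the statement of the socket `K2E1bGKCohomologyU21.U456.sig_K2E1bDegOneFinrankEqTwo`, bytes frozen.
Upper bound and finiteness: ★ T6b (`stub_T6b_degOneTypeFinrank`, `finrank_ℝ ≤ 2`); lower bound: the complex line through a non-zero class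
(`two_le_finrank_of_ne_bot`).  ROW-10 service (`stub_multiplicity_le_one_printed`, dim-1 half).
[cite: BorelWallach2000, VI Thm. 4.11 (3)] [cite: Rogawski1990, Prop. 15.2.1 (b)] -/
theorem DegOneFinrankEqTwo :
    ∀ (V : Type) [AddCommGroup V] [Module ℂ V]
      (ρK : Representation ℂ (uFormGroup (Fin 2) (Fin 1)).maximalCompact V)
      (ρ𝔤 : (uFormGroup (Fin 2) (Fin 1)).lie →ₗ⁅ℝ⁆ Module.End ℂ V) (h : IsCohUnitaryIrrep ρK ρ𝔤) (δ : ℤ), (δ = 1 ∨ δ = -1) →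
        upqTypeClasses ρK ρ𝔤 h.gk.ad_compat 1 δ ≠ ⊥ → Module.finrank ℝ ↥(upqTypeClasses ρK ρ𝔤 h.gk.ad_compat 1 δ) = 2 := by
  intro V _ _ ρK ρ𝔤 h δ _ hne
  obtain ⟨hfin, hle⟩ := stub_T6b_degOneTypeFinrank V ρK ρ𝔤 h δ
  exact le_antisymm hle (two_le_finrank_of_ne_bot ρK ρ𝔤 h.gk.ad_compat 1 δ hne)

end Summit.HodgeConjecture.HodgeConjecture.Cruxes.H413.K2E1bDegOneFinrankEqTwo

end
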